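import Literature.Topology.FourManifolds.AlexanderModuleCover
import Literature.Topology.FourManifolds.DehnSurgeryHomology
import Literature.Topology.FourManifolds.DehnSurgeryFramingTransfer

/-!
# Helper `helper_friendsCarrier_Vk_partA_partI` (V_k part A, part I: the tube framing is the Seifert
framing), piece 6: Hurewicz classes of explicit loops
(line `mk_friends`, crux `DcrGap`; item stmt-SmoothPoincare4-16128, route route-SmoothPoincare4-DottedCircleRasmussen)

Elementary facts about the degree-one Hurewicz class `h(γ) ∈ H₁(X; ℤ)` of a loop (the tree's `loopClass`,
`…SingularHomology.HurewiczOne`) used by the Mayer–Vietoris bookkeeping of part I: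

* `FriendsCarrierVk.loopClass_eq_of_loopConj'` — conjugate (freely homotopic) loops have the same class
  (`loopClass_conj_path` of the tree + homotopy invariance); `loopClass_eq_of_free_family` — the same for the two
  ends of a continuous `[0,1]`-family of closed loops with moving base point; `loopClass_eq_zero_of_const'` — a
  constant loop has class `0`;
* `FriendsCarrierVk.windH_loopClass_of_arg` — in `ℂ ∖ 0`, a loop of the form `t ↦ ρ(t) e^{2πimt}` has winding
  functional `2πim` (`windH`, continuous logarithms); `loopClass_eq_zero_of_convex` — a loop with values in a
  convex set missing `0` has class `0`; `eq_zero_of_zsmul_eq_zero_of_windH` — integer multiples of a class of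
  non-zero winding vanish only trivially.

* `helper_friendsCarrier_Vk_partA_partI_loops` — the registered statement.

No definitions, no named facts, no `sorry`.

## References

* A. Hatcher, *Algebraic Topology*, CUP (2002), Thm. 2A.1, Thm. 1.7, §1.1 Ex. 6. [HatcherAT2002]
-/

set_option linter.dupNamespace false
set_option linter.style.longLine false

noncomputable section

open scoped Topology unitInterval
open Function Set Metric Complex
open Literature.Topology.FourManifolds Literature.AlgebraicTopology.SingularHomology
  Literature.AlgebraicTopology.FundamentalGroup.PuncturedPlane

namespace Summit.SmoothPoincare4.SmoothPoincare4.Theorems.DcrGap.MkFriends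

namespace FriendsCarrierVk

/-! ## Free homotopy invariance of the Hurewicz class -/

/-- **Conjugate loops have the same Hurewicz class** (Hatcher 2002, Thm. 2A.1: `H₁` is abelian).
[cite: HatcherAT2002, Thm. 2A.1] -/
theorem loopClass_eq_of_loopConj' {X : Type} [TopologicalSpace X] {x y : X} {β₀ : Path x x} {β₁ : Path y y}
    (h : LoopConj β₀ β₁) : loopClass ℤ ℤ (1 : ℤ) β₀ = loopClass ℤ ℤ (1 : ℤ) β₁ := by
  obtain ⟨τ, hτ⟩ := h
  have h1 : loopClass ℤ ℤ (1 : ℤ) β₁ = loopClass ℤ ℤ (1 : ℤ) (τ.symm.trans (β₀.trans τ)) :=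
    loopClass_eq_of_homotopic ℤ ℤ 1 (Quotient.exact hτ)
  rw [h1]
  have h2 := loopClass_conj_path ℤ ℤ (1 : ℤ) τ.symm β₀
  rw [Path.symm_symm] at h2
  exact h2.symm

/-- **The two ends of a continuous family of closed loops have the same Hurewicz class** (base points may
move): `F : [0,1] × [0,1] → X` continuous with `F(s, 0) = F(s, 1)`, `β₀ = F(0, ·)`, `β₁ = F(1, ·)`.
[cite: HatcherAT2002, §1.1 Ex. 6] -/
theorem loopClass_eq_of_free_family {X : Type} [TopologicalSpace X] {x y : X} (F : I × I → X) (hF : Continuous F)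
    (hloop : ∀ s, F (s, 0) = F (s, 1)) (β₀ : Path x x) (β₁ : Path y y) (h₀ : ∀ t, β₀ t = F (0, t))
    (h₁ : ∀ t, β₁ t = F (1, t)) : loopClass ℤ ℤ (1 : ℤ) β₀ = loopClass ℤ ℤ (1 : ℤ) β₁ :=
  loopClass_eq_of_loopConj' (LoopConj.of_square ⟨F, hF⟩ hloop β₀ β₁ h₀ h₁)

/-- **A constant loop has Hurewicz class `0`.** [folklore] -/
theorem loopClass_eq_zero_of_const' {X : Type} [TopologicalSpace X] {x : X} (γ : Path x x) (h : ∀ t, γ t = x) :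
    loopClass ℤ ℤ (1 : ℤ) γ = 0 := by
  rw [loopClass_congr_fun (γ' := Path.refl x) fun t => by rw [h t]; rfl, loopClass_refl]

/-- **A loop which only moves its base point along a family of constant loops**: if `F(s, ·)` is constant for
`s = 1`, the loop `F(0, ·)` has class `0`. Convenience form of the two previous facts. [folklore] -/
theorem loopClass_eq_zero_of_free_family {X : Type} [TopologicalSpace X] {x : X} (F : I × I → X) (hF : Continuous F)
    (hloop : ∀ s, F (s, 0) = F (s, 1)) (β₀ : Path x x) (h₀ : ∀ t, β₀ t = F (0, t)) (h₁ : ∀ t, F (1, t) = F (1, 0)) :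
    loopClass ℤ ℤ (1 : ℤ) β₀ = 0 := by
  let β₁ : Path (F (1, 0)) (F (1, 0)) :=
    { toFun := fun t => F (1, t), continuous_toFun := hF.comp (Continuous.prodMk_right 1), source' := rfl, target' := h₁ 1 }
  rw [loopClass_eq_of_free_family F hF hloop β₀ β₁ h₀ (fun t => rfl)]
  exact loopClass_eq_zero_of_const' β₁ h₁

/-! ## Loops of the punctured plane -/

/-- **The winding functional of a loop of constant angular speed**: if `γ(t) = |γ(t)| e^{2πimt}` then
`windH h(γ) = 2πim` (Hatcher 2002, Thm. 1.7, through continuous logarithms). [cite: HatcherAT2002, Thm. 1.7] -/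
theorem windH_loopClass_of_arg {b : CStar} (γ : Path b b) (m : ℤ)
    (h : ∀ t : I, ((γ t : CStar) : ℂ) = ((‖((γ t : CStar) : ℂ)‖ : ℝ) : ℂ) * exp (((2 * Real.pi * m * t : ℝ) : ℂ) * Complex.I)) :
    windH (loopClass ℤ ℤ (1 : ℤ) γ) = 2 * Real.pi * m * Complex.I := by
  rw [windH_loopClass]
  set l : ℝ → ℂ := fun t => ((Real.log ‖((γ (projIcc 0 1 zero_le_one t) : CStar) : ℂ)‖ : ℝ) : ℂ) + ((2 * Real.pi * m * t : ℝ) : ℂ) * Complex.I with hl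
  have hγc : Continuous fun t : ℝ => ((γ (projIcc 0 1 zero_le_one t) : CStar) : ℂ) :=
    continuous_subtype_val.comp (γ.continuous.comp continuous_projIcc)
  have hne : ∀ t : ℝ, ((γ (projIcc 0 1 zero_le_one t) : CStar) : ℂ) ≠ 0 := fun t => (γ _).2
  have hlc : Continuous l := by
    refine Continuous.add ?_ (by fun_prop)
    exact continuous_ofReal.comp ((hγc.norm).log fun t => (norm_ne_zero_iff.2 (hne t)))
  have e1 : γ (projIcc 0 1 zero_le_one 1) = b := by rw [projIcc_right]; exact γ.target
  have e0 : γ (projIcc 0 1 zero_le_one 0) = b := by rw [projIcc_left]; exact γ.source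
  rw [edgeLog_eq (l := l) hlc.continuousOn fun t ht => ?_]
  · simp only [hl]
    rw [e1, e0]
    push_cast; ring
  · rw [edgeFun_ofPath _ ht, hl]
    simp only
    rw [Complex.exp_add, projIcc_of_mem _ ht, ← Complex.ofReal_exp, Real.exp_log (norm_pos_iff.2 (γ ⟨t, ht⟩).2)]
    exact (h ⟨t, ht⟩).symm

/-- **A loop of `ℂ ∖ 0` with values in a convex set missing `0` has Hurewicz class `0`** (straight-line
homotopy to the constant loop). [folklore] -/
theorem loopClass_eq_zero_of_convex {b : CStar} (γ : Path b b) (K : Set ℂ) (hK : Convex ℝ K) (h0 : (0 : ℂ) ∉ K)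
    (hγ : ∀ t, ((γ t : CStar) : ℂ) ∈ K) : loopClass ℤ ℤ (1 : ℤ) γ = 0 := by
  have hmem : ∀ p : I × I, ((1 - (p.1 : ℝ)) • ((γ p.2 : CStar) : ℂ) + (p.1 : ℝ) • ((γ 0 : CStar) : ℂ)) ∈ K := fun p =>
    hK (hγ p.2) (hγ 0) (by linarith [p.1.2.2]) p.1.2.1 (by ring)
  refine loopClass_eq_zero_of_free_family
    (fun p : I × I => (⟨(1 - (p.1 : ℝ)) • ((γ p.2 : CStar) : ℂ) + (p.1 : ℝ) • ((γ 0 : CStar) : ℂ), fun h => h0 (h ▸ hmem p)⟩ : CStar))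
    (Continuous.subtype_mk (by fun_prop) _) (fun s => ?_) γ (fun t => ?_) (fun t => ?_)
  · apply Subtype.ext; simp only [γ.source, γ.target]
  · apply Subtype.ext; simp
  · apply Subtype.ext; simp

/-- **Integer multiples of a class of non-zero winding vanish only trivially**: if `windH c = 2πim`, `m ≠ 0`,
and `a • c = 0` then `a = 0`. [folklore] -/
theorem eq_zero_of_zsmul_eq_zero_of_windH {c : singularHomology ℤ ℤ CStar 1} {m : ℤ} (hm : m ≠ 0)
    (hc : windH c = 2 * Real.pi * m * Complex.I) {a : ℤ} (h : a • c = 0) : a = 0 := by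
  have h1 := congrArg windH h
  rw [map_zsmul, hc, map_zero, zsmul_eq_mul] at h1
  have h2 : (2 * Real.pi * Complex.I : ℂ) ≠ 0 := by simp [Real.pi_ne_zero, Complex.I_ne_zero]
  have h3 : ((a : ℂ) * m) * (2 * Real.pi * Complex.I) = 0 := by rw [← h1]; ring
  rcases mul_eq_zero.1 h3 with h4 | h4
  · rcases mul_eq_zero.1 h4 with h5 | h5
    · exact_mod_cast h5
    · exact absurd (by exact_mod_cast h5) hm
  · exact absurd h4 h2

end FriendsCarrierVk

open FriendsCarrierVk in
/-- **Piece 6 of part I of V_k part A: Hurewicz classes of explicit loops.**  The two ends of a continuous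
family of closed loops (base points may move) have the same Hurewicz class; in `ℂ ∖ 0` a loop
`t ↦ |γ(t)| e^{2πimt}` has winding functional `2πim`, a loop with values in a convex set missing `0` has class
`0`, and integer multiples of a class of non-zero winding vanish only trivially. [cite: HatcherAT2002, Thm. 2A.1] -/
theorem helper_friendsCarrier_Vk_partA_partI_loops : (∀ (X : Type) [TopologicalSpace X] (x y : X) (F : unitInterval × unitInterval → X) (β₀ : Path x x) (β₁ : Path y y), Continuous F → (∀ s, F (s, 0) = F (s, 1)) → (∀ t, β₀ t = F (0, t)) → (∀ t, β₁ t = F (1, t)) → Literature.AlgebraicTopology.SingularHomology.loopClass ℤ ℤ (1 : ℤ) β₀ = Literature.AlgebraicTopology.SingularHomology.loopClass ℤ ℤ (1 : ℤ) β₁) ∧ (∀ (b : Literature.AlgebraicTopology.FundamentalGroup.PuncturedPlane.CStar) (γ : Path b b) (m : ℤ), (∀ t : unitInterval, ((γ t : Literature.AlgebraicTopology.FundamentalGroup.PuncturedPlane.CStar) : ℂ) = ((‖((γ t : Literature.AlgebraicTopology.FundamentalGroup.PuncturedPlane.CStar) : ℂ)‖ : ℝ) : ℂ) * Complex.exp (((2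 * Real.pi * m * t : ℝ) : ℂ) * Complex.I)) → Literature.AlgebraicTopology.SingularHomology.windH (Literature.AlgebraicTopology.SingularHomology.loopClass ℤ ℤ (1 : ℤ) γ) = 2 * Real.pi * m * Complex.I) ∧ (∀ (b : Literature.AlgebraicTopology.FundamentalGroup.PuncturedPlane.CStar) (γ : Path b b) (K : Set ℂ), Convex ℝ K → (0 : ℂ) ∉ K → (∀ t, ((γ t : Literature.AlgebraicTopology.FundamentalGroup.PuncturedPlane.CStar) : ℂ) ∈ K) → Literature.AlgebraicTopology.SingularHomology.loopClass ℤ ℤ (1 : ℤ) γ = 0) ∧ ∀ (c : Literature.AlgebraicTopology.SingularHomology.singularHomology ℤ ℤ Literature.AlgebraicTopology.FundamentalGroup.PuncturedPlane.CStar 1) (m a : ℤ), m ≠ 0 → Literature.AlgebraicTopology.SingularHomology.windH c = 2 * Real.pi * m * Complex.I → a • c = 0 → a = 0 :=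
  ⟨fun _ _ _ _ F β₀ β₁ hF hl h₀ h₁ => loopClass_eq_of_free_family F hF hl β₀ β₁ h₀ h₁, fun _ γ m h => windH_loopClass_of_arg γ m h,
    fun _ γ K hK h0 hγ => loopClass_eq_zero_of_convex γ K hK h0 hγ, fun _ _ _ hm hc h => eq_zero_of_zsmul_eq_zero_of_windH hm hc h⟩

end Summit.SmoothPoincare4.SmoothPoincare4.Theorems.DcrGap.MkFriends
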